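import Literature.AlgebraicGeometry.Motives.MixedHodgeStructureStrictProofs
import Literature.AlgebraicGeometry.Motives.HodgeStructureDirectSum
import HarnessLib

/-!
# Hodge classes of a mixed Hodge structure: comparison with `Gr^W` and exactness
# (Arapura 2022, Lemma 1.1)

Layer `Literature/AlgebraicGeometry/Motives`; sequel to `MixedHodgeStructure` (mixed `ℚ`-Hodge
structures, `Gr^W_k`, morphisms, `Hom.gr`), `MixedHodgeStructureStrictProofs` (morphisms are
strict, Deligne, Hodge II, Thm. 2.3.5 (iii) — PROVED there) and `HodgeStructureSemisimple` /
`HodgeStructureDirectSum` (Voisin 2025, Prop. 2.11 and Cor. 2.12: Hodge classes lift along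
morphisms from polarisable pure Hodge structures — PROVED there). Everything here is PROVED; no
named fact is introduced.

Source, verbatim (D. Arapura, *Hodge cycles and the Leray filtration*, Pacific J. Math. 319
(2022) 233–258 = arXiv:2103.05038, §1, p. 3 of the held text `paper:arxiv-2103.05038`):
"Given a mixed Hodge structure `H`, set `Hodge(H) := Hom_MHS(ℚ(0), H)`. The following facts will
often be used without comment below. **Lemma 1.1.** (1) There is an injection
`Hodge(H) ↪ Hodge(Gr^W_0 H)`. It is an isomorphism if `H` has nonnegative weight, i.e.
`W_{-1}H = 0`. (2) `Hodge(−)` is an exact functor on the category of polarizable mixed Hodge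
structures of nonnegative weight. (3) If `H₁ → H₂ → H₃` is an exact sequence of mixed Hodge
structures, such that `H₁` is polarizable with nonnegative weight, then
`Hodge(H₁) → Hodge(H₂) → Hodge(H₃)` is exact. […] *Proof.* The first item follows from
strictness of the weight filtration [Deligne]. The second follows from (1) and the
semisimplicity of the category of pure polarizable Hodge structures. Statement (3) follows from
(1) and (2) […]."

## Rendering

For an MHS `H` on `V` (the tree's `MixedHodgeStructure V`) and `p : ℤ`,
`MixedHodgeStructure.hodgeClasses H p := {v ∈ V | v ∈ W_{2p} V, 1 ⊗ v ∈ Fᵖ V_ℂ}` — the rational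
classes of type `(p, p)`, i.e. `Hom_MHS(ℚ(-p), H) = Hodge(H(p))` in Arapura's notation (a
morphism `ℚ(-p) → H` is the choice of the image `v` of `1`: `ℚ(-p)` is pure of weight `2p` with
`F^p = everything ⊋ F^{p+1} = 0`). Working with all `p` at once replaces the Tate twist `H(p)` of
the source; "`H(p)` has nonnegative weight" reads `W_{2p-1} V = 0`, and "polarizable" is used only
through a polarisation of the pure piece `Gr^W_{2p}` (`(H.gr (2 * p)).IsPolarizable`, implied by
the tree's `IsGradedPolarizable`).

## Main results (namespace `MixedHodgeStructure`)

* `hodgeClasses`, `mem_hodgeClasses_iff`, `Hom.apply_mem_hodgeClasses` (morphisms preserve Hodge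
  classes), `HodgeStructure.toMixedHodgeStructure_hodgeClasses` (agrees with the pure notion).
* Weights: `HodgeStructure.hodgeClasses_eq_bot_of_lt` (a pure Hodge structure of weight `< 2p`
  has no non-zero rational class in `Fᵖ`: `Fᵖ ∩ conj Fᵖ ⊆ Fᵖ ∩ conj F^{n+1-p} = 0`) and its mixed
  consequence `eq_zero_of_mem_W_of_lt` (a rational `v ∈ W_k`, `k < 2p`, with `1 ⊗ v ∈ Fᵖ`
  vanishes — descend the weight filtration one `Gr^W_k` at a time).
* **Lemma 1.1 (1)**: `hodgeClassesToGr` (`Hdgᵖ(H) → Hdgᵖ(Gr^W_{2p} H)`, `v ↦ [v]`),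
  `hodgeClassesToGr_injective`, and for `W_{2p-1} = 0` the surjectivity
  `exists_mem_hodgeClasses_toGr_eq` and the equivalence `hodgeClassesEquivGr`.
* **Lemma 1.1 (3)** (hence (2)): `Hom.exists_mem_hodgeClasses_apply_eq_of_mem_range` — for a
  morphism `f : H₁ → H₂` of MHS with `V₁` finite-dimensional, `W_{2p-1} V₁ = 0` and `Gr^W_{2p} H₁`
  polarisable, every Hodge class of `H₂` in the image of `f` is the image of a Hodge class of
  `H₁`, i.e. `f(Hdgᵖ H₁) = Hdgᵖ H₂ ∩ im f` (`Hom.map_hodgeClasses_eq_inf_range`); the printed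
  three-term form `Hom.exists_mem_hodgeClasses_apply_eq_of_exact` (exactness of
  `Hdg(H₁) → Hdg(H₂) → Hdg(H₃)` at `H₂` when `ker g ⊆ im f`), and **(2)** the surjective case
  `Hom.map_hodgeClasses_eq_of_surjective`.

The proof of (3) is the printed one made explicit: by strictness for `W` a Hodge class
`v ∈ im f` has a preimage in `W_{2p} V₁ = Gr^W_{2p} V₁`; its class `[v] ∈ Hdgᵖ(Gr^W_{2p} H₂)` lies in
the image of the morphism of pure Hodge structures `Gr^W_{2p}(f)`, so lifts to a Hodge class `u`
of the polarisable `Gr^W_{2p} H₁ = Hdg`-part of `H₁` (Voisin 2025, Cor. 2.12 in the "image" form,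
`HodgeStructure.Hom.exists_mem_hodgeClasses_eq_of_mem_range'`, from the tree's surjective form by
co-restriction to the image sub-Hodge structure); then `f u - v` is a Hodge class of `H₂` in
`W_{2p-1}`, hence `0` by (1). Part (4) of the lemma (a `Gr⁰_F`-criterion on PURE Hodge
structures) is not used in §1 of the source; it is rendered in the appended section (v2) below.

## Appended (v2): Lemma 1.1 (4)

"(4) If `φ : H₁ → H₂` is a morphism of polarizable Hodge structures, such that
`Gr⁰_F H₁ → Gr⁰_F H₂` is surjective (resp. injective) then `Hodge(H₁) → Hodge(H₂)` is surjective
(resp. injective). […] Given `φ : H₁ → H₂` inducing a surjective map `Gr⁰_F H₁ → Gr⁰_F H₂`, let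
`H₃ = coker φ`. Then `coker(Hodge(H₁) → Hodge(H₂)) = Hodge(H₃) ⊆ Gr⁰_F H₃ = 0`. The injectivity
part of (4) is similar." Untwisted to weight `n = 2p` (`Gr⁰_F` of `H(p)` is `Grᵖ_F` of `H`), with
the conditions on `Grᵖ_F(φ) : Fᵖ/F^{p+1} → Fᵖ/F^{p+1}` spelled out on the filtrations:
`HodgeStructure.Hom.eq_zero_of_mem_hodgeClasses_of_grF_injective` (injective half — no
polarisation needed: a Hodge class killed by `φ` has `1 ⊗ h ∈ F^{p+1} ∩ conj Fᵖ = 0`) and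
`HodgeStructure.Hom.hodgeClasses_le_map_of_grF_surjective` (surjective half, `H₁`
finite-dimensional and polarisable: writing `1 ⊗ h = φ_ℂ x + y`, `x ∈ Fᵖ`, `y ∈ F^{p+1}`, and
splitting `x = x' + b` along `V₁,ℂ = F^{p+1} ⊕ conj Fᵖ`, the defect `1 ⊗ h - φ_ℂ b` lies in
`F^{p+1} ∩ conj Fᵖ = 0`, so `h ∈ im φ` — `(im φ)_ℂ ∩ V₂ = im φ` — and Hodge classes in the image
lift by Cor. 2.12; this replaces the cokernel of the printed proof by the same weight argument
inside `H₂`).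

## References

* [Arapura2022] D. Arapura, Hodge cycles and the Leray filtration, Pacific J. Math. 319 (2022)
  233–258, doi:10.2140/pjm.2022.319.233 = arXiv:2103.05038, §1 Lemma 1.1 (p. 3 of the held text).
* [DeligneHodgeII1971] P. Deligne, Théorie de Hodge II, Publ. Math. IHÉS 40 (1971), Thm. 2.3.5
  (iii) (strictness), 2.1 (Hodge classes).
* [Voisin2025] C. Voisin, Hodge and generalized Hodge conjectures, coniveau and algebraic cycles,
  J. Open Math. Probl. 1 (2025), Prop. 2.11, Cor. 2.12.
* [CattaniElZeinGriffithsLe2014] E. Cattani et al. (eds.), Hodge Theory (2014), Def. 3.2.15,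
  Cor. 3.2.21.
-/

open scoped TensorProduct

noncomputable section

namespace Literature.AlgebraicGeometry.Motives

universe u v w

variable {V : Type u} [AddCommGroup V] [Module ℚ V]
variable {V' : Type v} [AddCommGroup V'] [Module ℚ V']
variable {V'' : Type w} [AddCommGroup V''] [Module ℚ V'']

open HodgeStructure (ofRat ofRat_apply conj conj_ofRat complexConj mem_complexConj
  complexConj_mono ofRat_injective)

/-! ### Two facts on pure Hodge structures -/

namespace HodgeStructure

variable {n : ℤ}

/-- **Weights.** A pure Hodge structure of weight `n < 2p` has no non-zero rational class in
`Fᵖ`: for `v` rational, `1 ⊗ v ∈ Fᵖ` is real, so lies in `Fᵖ ∩ conj Fᵖ ⊆ Fᵖ ∩ conj F^{n+1-p} = 0`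
(`n + 1 - p ≤ p`). This is the vanishing `Hom_MHS(ℚ(-p), H) = 0` for `H` pure of weight `≠ 2p`
behind Arapura's Lemma 1.1 (1). [cite: Arapura2022, §1 Lemma 1.1 (1)]
[cite: DeligneHodgeII1971, 2.1] -/
theorem hodgeClasses_eq_bot_of_lt (G : HodgeStructure V n) {p : ℤ} (h : n < 2 * p) :
    G.hodgeClasses p = ⊥ := by
  rw [eq_bot_iff]
  intro u hu
  rw [Submodule.mem_bot]
  rw [mem_hodgeClasses_iff] at hu
  have hconj : ofRat u ∈ complexConj (G.F (n + 1 - p)) := by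
    rw [mem_complexConj, conj_ofRat]
    exact G.antitone_F (show n + 1 - p ≤ p by omega) hu
  have hbot : ofRat u ∈ G.F p ⊓ complexConj (G.F (n + 1 - p)) := ⟨hu, hconj⟩
  rw [(G.isCompl_F_complexConj p (n + 1 - p) (by ring)).inf_eq_bot, Submodule.mem_bot] at hbot
  exact ofRat_injective (by rw [hbot, map_zero])

/-- **Hodge classes in the image of a morphism from a polarisable Hodge structure lift to Hodge
classes** (Voisin 2025, Cor. 2.12, "image" form): for `φ : H′ → H` of weight `n = 2p` with `H′`
finite-dimensional and polarisable, a Hodge class of `H` lying in `im φ` is `φ h′` for a Hodge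
class `h′` of `H′`. From the tree's surjective form `Hom.exists_mem_hodgeClasses_eq_of_surjective`
by co-restricting `φ` to its image, a sub-Hodge structure (`Hom.exists_subHodgeStructure_range`,
`Hom.codRestrict`). (The same statement is proved in `HodgeTheory/HodgeConjectureQbarVoisinProofs`
as `Hom.exists_mem_hodgeClasses_eq_of_mem_range`; it is re-derived here to keep the import cone
of this abstract file free of the geometric carriers.) [cite: Voisin2025, Cor. 2.12] -/
theorem Hom.exists_mem_hodgeClasses_eq_of_mem_range' [Module.Finite ℚ V']
    {H' : HodgeStructure V' n} {H : HodgeStructure V n} (φ : Hom H' H) (hH' : H'.IsPolarizable)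
    {p : ℤ} (hp : p + p = n) {h : V} (hh : h ∈ H.hodgeClasses p)
    (hrange : h ∈ LinearMap.range φ.toLinearMap) :
    ∃ h' ∈ H'.hodgeClasses p, φ.toLinearMap h' = h := by
  obtain ⟨S, hS⟩ := φ.exists_subHodgeStructure_range
  have hmem : ∀ x, φ.toLinearMap x ∈ S.toSubmodule := fun x ↦ by
    rw [hS]
    exact LinearMap.mem_range_self _ x
  have hψ : Function.Surjective (φ.codRestrict S hmem).toLinearMap := by
    rintro ⟨s, hs⟩
    have hs' : s ∈ LinearMap.range φ.toLinearMap := by rwa [hS] at hs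
    obtain ⟨x, hx⟩ := hs'
    exact ⟨x, Subtype.ext hx⟩
  have hhS : (⟨h, (hS ▸ hrange : h ∈ S.toSubmodule)⟩ : S.toSubmodule) ∈
      S.toHodgeStructure.hodgeClasses p :=
    (S.mem_hodgeClasses_iff p _).2 hh
  obtain ⟨h', hh', hψh'⟩ :=
    (φ.codRestrict S hmem).exists_mem_hodgeClasses_eq_of_surjective hψ hH' hp hhS
  exact ⟨h', hh', congrArg Subtype.val hψh'⟩

end HodgeStructure

namespace MixedHodgeStructure

/-! ### Hodge classes of a mixed Hodge structure -/

/-- The **Hodge classes of type `(p, p)`** of a mixed Hodge structure `H` on `V`: the rational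
vectors `v ∈ W_{2p} V` with `1 ⊗ v ∈ Fᵖ V_ℂ`. These are the images of `1` under the morphisms
`ℚ(-p) → H` of mixed Hodge structures, i.e. Arapura's `Hodge(H(p)) = Hom_MHS(ℚ(0), H(p))`
("Given a mixed Hodge structure `H`, set `Hodge(H) := Hom_MHS(ℚ(0), H)`").
[cite: Arapura2022, §1 (p. 3)] [cite: DeligneHodgeII1971, 2.1 and 2.3.1] -/
def hodgeClasses (H : MixedHodgeStructure V) (p : ℤ) : Submodule ℚ V :=
  H.W (2 * p) ⊓ ((H.F p).restrictScalars ℚ).comap ofRat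

/-- Membership in `hodgeClasses`: `v ∈ W_{2p}` and `1 ⊗ v ∈ Fᵖ`. [cite: Arapura2022, §1 (p. 3)] -/
theorem mem_hodgeClasses_iff (H : MixedHodgeStructure V) (p : ℤ) (v : V) :
    v ∈ H.hodgeClasses p ↔ v ∈ H.W (2 * p) ∧ ofRat v ∈ H.F p :=
  Iff.rfl

/-- Hodge classes lie in `W_{2p}`. [cite: Arapura2022, §1 (p. 3)] -/
theorem hodgeClasses_le_W (H : MixedHodgeStructure V) (p : ℤ) : H.hodgeClasses p ≤ H.W (2 * p) :=
  inf_le_left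

/-- **Morphisms of mixed Hodge structures preserve Hodge classes** (`Hodge(−)` is a functor:
`f(W_{2p}) ⊆ W_{2p}` and `f_ℂ(Fᵖ) ⊆ Fᵖ`). [cite: Arapura2022, §1 Lemma 1.1]
[cite: DeligneHodgeII1971, 2.3.1] -/
theorem Hom.apply_mem_hodgeClasses {H₁ : MixedHodgeStructure V} {H₂ : MixedHodgeStructure V'}
    (f : Hom H₁ H₂) {p : ℤ} {v : V} (hv : v ∈ H₁.hodgeClasses p) :
    f.toLinearMap v ∈ H₂.hodgeClasses p := by
  refine ⟨f.map_W_le _ ⟨v, hv.1, rfl⟩, ?_⟩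
  have h : f.toLinearMap.baseChange ℂ (ofRat v) = ofRat (f.toLinearMap v) := by
    rw [ofRat_apply, ofRat_apply, LinearMap.baseChange_tmul]
  show ofRat (f.toLinearMap v) ∈ H₂.F p
  rw [← h]
  exact f.map_F_le p ⟨_, hv.2, rfl⟩

/-- `f(Hdgᵖ H₁) ⊆ Hdgᵖ H₂`. [cite: Arapura2022, §1 Lemma 1.1] -/
theorem Hom.map_hodgeClasses_le {H₁ : MixedHodgeStructure V} {H₂ : MixedHodgeStructure V'}
    (f : Hom H₁ H₂) (p : ℤ) : (H₁.hodgeClasses p).map f.toLinearMap ≤ H₂.hodgeClasses p := by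
  rintro _ ⟨v, hv, rfl⟩
  exact f.apply_mem_hodgeClasses hv

/-- For a pure Hodge structure of weight `n ≤ 2p` seen as an MHS (`W_k = 0` for `k < n`,
`W_k = V` for `k ≥ n`), the Hodge classes are the pure ones `V ∩ Fᵖ`.
[cite: CattaniElZeinGriffithsLe2014, Ex. 3.2.23 (1)] -/
theorem _root_.Literature.AlgebraicGeometry.Motives.HodgeStructure.toMixedHodgeStructure_hodgeClasses
    {n : ℤ} (G : HodgeStructure V n) {p : ℤ} (hp : n ≤ 2 * p) :
    G.toMixedHodgeStructure.hodgeClasses p = G.hodgeClasses p := by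
  ext v
  rw [mem_hodgeClasses_iff, HodgeStructure.toMixedHodgeStructure_W,
    HodgeStructure.trivialWeightFiltration_of_le hp, HodgeStructure.toMixedHodgeStructure_F,
    HodgeStructure.mem_hodgeClasses_iff]
  exact ⟨fun h ↦ h.2, fun h ↦ ⟨Submodule.mem_top, h⟩⟩

/-! ### The class of a Hodge class in `Gr^W`, and weights -/

/-- The class in `Gr^W_k` of a rational `v ∈ W_k` with `1 ⊗ v ∈ Fᵖ` is a rational class in
`Fᵖ Gr^W_k` (the induced filtration: `1 ⊗ v ∈ Fᵖ ∩ W_{k,ℂ}` projects to `1 ⊗ [v]`).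
[cite: Arapura2022, §1 Lemma 1.1 (1)] [cite: DeligneHodgeII1971, 2.3.1] -/
theorem mk_mem_hodgeClasses_gr (H : MixedHodgeStructure V) {k p : ℤ} {v : V} (hW : v ∈ H.W k)
    (hF : ofRat v ∈ H.F p) :
    (Submodule.Quotient.mk ⟨v, hW⟩ : grW H.W k) ∈ (H.gr k).hodgeClasses p := by
  rw [HodgeStructure.mem_hodgeClasses_iff, gr_F, grF]
  refine ⟨ofRat (⟨v, hW⟩ : H.W k), ?_, ?_⟩
  · show grIncl H.W k (ofRat (⟨v, hW⟩ : H.W k)) ∈ H.F p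
    rw [ofRat_apply, LinearMap.baseChange_tmul]
    exact hF
  · rw [ofRat_apply, ofRat_apply, LinearMap.baseChange_tmul]
    rfl

/-- One step down the weight filtration: a rational `v ∈ W_k` with `1 ⊗ v ∈ Fᵖ` and `k < 2p`
lies in `W_{k-1}` — its class in the pure `Gr^W_k` (weight `k < 2p`) is a rational class in `Fᵖ`,
hence `0` (`HodgeStructure.hodgeClasses_eq_bot_of_lt`). [cite: Arapura2022, §1 Lemma 1.1 (1)]
[cite: DeligneHodgeII1971, Thm. 2.3.5] -/
theorem mem_W_sub_one_of_lt (H : MixedHodgeStructure V) {k p : ℤ} (hk : k < 2 * p) {v : V}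
    (hW : v ∈ H.W k) (hF : ofRat v ∈ H.F p) : v ∈ H.W (k - 1) := by
  have h0 : (Submodule.Quotient.mk ⟨v, hW⟩ : grW H.W k) = 0 := by
    have h := mk_mem_hodgeClasses_gr H hW hF
    rw [HodgeStructure.hodgeClasses_eq_bot_of_lt (H.gr k) hk, Submodule.mem_bot] at h
    exact h
  rw [Submodule.Quotient.mk_eq_zero] at h0
  exact h0

/-- **Weights, mixed form**: a rational `v ∈ W_k V` with `1 ⊗ v ∈ Fᵖ` and `k < 2p` is zero
(descend from `W_k` to `W_{k-1}` to … to `W_b = 0`). Equivalently `Hom_MHS(ℚ(-p), W_k H) = 0` for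
`k < 2p`. [cite: Arapura2022, §1 Lemma 1.1 (1)] [cite: DeligneHodgeII1971, Thm. 2.3.5] -/
theorem eq_zero_of_mem_W_of_lt (H : MixedHodgeStructure V) {k p : ℤ} (hk : k < 2 * p) {v : V}
    (hW : v ∈ H.W k) (hF : ofRat v ∈ H.F p) : v = 0 := by
  obtain ⟨b, hb⟩ := H.exists_W_eq_bot
  suffices key : ∀ (m : ℕ) (k : ℤ), k ≤ b + m → k < 2 * p → ∀ v ∈ H.W k, ofRat v ∈ H.F p →
      v = 0 by
    rcases le_or_gt k b with hkb | hkb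
    · exact key 0 k (by simpa using hkb) hk v hW hF
    · exact key (k - b).toNat k (by omega) hk v hW hF
  intro m
  induction m with
  | zero =>
    intro k hkb _ v hv _
    have h : v ∈ H.W b := H.monotone_W (by simpa using hkb) hv
    rwa [hb, Submodule.mem_bot] at h
  | succ m ih =>
    intro k hkb hkp v hv hvF
    exact ih (k - 1) (by omega) (by omega) v (mem_W_sub_one_of_lt H hkp hv hvF) hvF

/-! ### Lemma 1.1 (1): `Hdg(H) ↪ Hdg(Gr^W H)`, an isomorphism in nonnegative weight -/

/-- **A Hodge class lying in `W_{2p-1}` vanishes** (the kernel of `Hdgᵖ(H) → Hdgᵖ(Gr^W_{2p} H)` is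
zero: "the first item follows from strictness of the weight filtration").
[cite: Arapura2022, §1 Lemma 1.1 (1)] -/
theorem eq_zero_of_mem_hodgeClasses_of_mem_W (H : MixedHodgeStructure V) {p : ℤ} {v : V}
    (hv : v ∈ H.hodgeClasses p) (hW : v ∈ H.W (2 * p - 1)) : v = 0 :=
  eq_zero_of_mem_W_of_lt H (by omega) hW hv.2

/-- `Hdgᵖ(H) ∩ W_{2p-1} = 0`. [cite: Arapura2022, §1 Lemma 1.1 (1)] -/
theorem hodgeClasses_inf_W_eq_bot (H : MixedHodgeStructure V) (p : ℤ) :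
    H.hodgeClasses p ⊓ H.W (2 * p - 1) = ⊥ := by
  rw [eq_bot_iff]
  rintro v ⟨hv, hW⟩
  rw [Submodule.mem_bot]
  exact eq_zero_of_mem_hodgeClasses_of_mem_W H hv hW

/-- The comparison map `Hdgᵖ(H) → Gr^W_{2p} V`, `v ↦ [v]` (Arapura's
`Hodge(H) → Hodge(Gr^W_0 H)`, before co-restriction to its image). [cite: Arapura2022, §1 Lemma 1.1 (1)] -/
def hodgeClassesToGr (H : MixedHodgeStructure V) (p : ℤ) : H.hodgeClasses p →ₗ[ℚ] grW H.W (2 * p) :=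
  (subPiece H.W (2 * p)).mkQ ∘ₗ Submodule.inclusion (hodgeClasses_le_W H p)

/-- `hodgeClassesToGr` on `v` is the class of `v`. [cite: Arapura2022, §1 Lemma 1.1 (1)] -/
@[simp]
theorem hodgeClassesToGr_apply (H : MixedHodgeStructure V) (p : ℤ) (v : H.hodgeClasses p) :
    H.hodgeClassesToGr p v = Submodule.Quotient.mk ⟨(v : V), v.2.1⟩ :=
  rfl

/-- The comparison map lands in the Hodge classes of the pure `Gr^W_{2p} H`.
[cite: Arapura2022, §1 Lemma 1.1 (1)] -/
theorem hodgeClassesToGr_mem (H : MixedHodgeStructure V) (p : ℤ) (v : H.hodgeClasses p) :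
    H.hodgeClassesToGr p v ∈ (H.gr (2 * p)).hodgeClasses p :=
  mk_mem_hodgeClasses_gr H v.2.1 v.2.2

/-- **Lemma 1.1 (1), injectivity: `Hodge(H) ↪ Hodge(Gr^W H)`.** [cite: Arapura2022, §1 Lemma 1.1 (1)] -/
theorem hodgeClassesToGr_injective (H : MixedHodgeStructure V) (p : ℤ) :
    Function.Injective (H.hodgeClassesToGr p) := by
  rw [← LinearMap.ker_eq_bot, eq_bot_iff]
  rintro ⟨v, hv⟩ h0
  rw [LinearMap.mem_ker, hodgeClassesToGr_apply, Submodule.Quotient.mk_eq_zero] at h0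
  rw [Submodule.mem_bot, Subtype.ext_iff]
  exact eq_zero_of_mem_hodgeClasses_of_mem_W H hv h0

/-- **Lemma 1.1 (1), surjectivity in nonnegative weight**: if `W_{2p-1} V = 0` ("`H(p)` has
nonnegative weight"), every Hodge class of `Gr^W_{2p} H` is the class of a Hodge class of `H`
(then `W_{2p} = Gr^W_{2p}` and `Fᵖ Gr^W_{2p} = Fᵖ ∩ W_{2p,ℂ}`). [cite: Arapura2022, §1 Lemma 1.1 (1)] -/
theorem exists_mem_hodgeClasses_toGr_eq (H : MixedHodgeStructure V) {p : ℤ}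
    (hbot : H.W (2 * p - 1) = ⊥) {y : grW H.W (2 * p)} (hy : y ∈ (H.gr (2 * p)).hodgeClasses p) :
    ∃ v : H.hodgeClasses p, H.hodgeClassesToGr p v = y := by
  obtain ⟨x, rfl⟩ := Submodule.Quotient.mk_surjective _ y
  rw [HodgeStructure.mem_hodgeClasses_iff, gr_F, grF] at hy
  obtain ⟨z, hz, hzx⟩ := hy
  have hker : z - ofRat x ∈ LinearMap.ker (grProj H.W (2 * p)) := by
    rw [LinearMap.mem_ker, map_sub, hzx, ofRat_apply, ofRat_apply, LinearMap.baseChange_tmul,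
      Submodule.mkQ_apply, sub_self]
  have hsub : subPiece H.W (2 * p) = ⊥ := by
    rw [subPiece, hbot, Submodule.submoduleOf, Submodule.comap_bot, Submodule.ker_subtype]
  rw [ker_grProj, hsub, Submodule.baseChange_bot, Submodule.mem_bot, sub_eq_zero] at hker
  subst hker
  have hxF : ofRat (x : V) ∈ H.F p := by
    have h : grIncl H.W (2 * p) (ofRat x) ∈ H.F p := hz
    rw [ofRat_apply, LinearMap.baseChange_tmul] at h
    exact h
  exact ⟨⟨(x : V), x.2, hxF⟩, rfl⟩

/-- **Lemma 1.1 (1): `Hodge(H) ≅ Hodge(Gr^W H)` in nonnegative weight** — for `W_{2p-1} V = 0`,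
`v ↦ [v]` is a linear equivalence `Hdgᵖ(H) ≃ Hdgᵖ(Gr^W_{2p} H)`. [cite: Arapura2022, §1 Lemma 1.1 (1)] -/
def hodgeClassesEquivGr (H : MixedHodgeStructure V) (p : ℤ) (hbot : H.W (2 * p - 1) = ⊥) :
    H.hodgeClasses p ≃ₗ[ℚ] (H.gr (2 * p)).hodgeClasses p :=
  LinearEquiv.ofBijective ((H.hodgeClassesToGr p).codRestrict _ (hodgeClassesToGr_mem H p))
    ⟨by
      intro a b hab
      exact hodgeClassesToGr_injective H p (congrArg Subtype.val hab),
     by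
      rintro ⟨y, hy⟩
      obtain ⟨v, hv⟩ := exists_mem_hodgeClasses_toGr_eq H hbot hy
      exact ⟨v, Subtype.ext hv⟩⟩

/-- The equivalence on `v` is the class of `v`. [cite: Arapura2022, §1 Lemma 1.1 (1)] -/
@[simp]
theorem coe_hodgeClassesEquivGr_apply (H : MixedHodgeStructure V) (p : ℤ)
    (hbot : H.W (2 * p - 1) = ⊥) (v : H.hodgeClasses p) :
    ((H.hodgeClassesEquivGr p hbot v : (H.gr (2 * p)).hodgeClasses p) : grW H.W (2 * p)) =
      Submodule.Quotient.mk ⟨(v : V), v.2.1⟩ :=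
  rfl

/-! ### Lemma 1.1 (3) and (2): exactness of `Hodge(−)` -/

/-- **Lemma 1.1 (3), core: Hodge classes in the image of a morphism of MHS lift to Hodge classes**,
when the source `H₁` is finite-dimensional with `W_{2p-1} V₁ = 0` (nonnegative weight after the
twist) and `Gr^W_{2p} H₁` polarisable. Printed proof: strictness for `W` gives a preimage in
`W_{2p} V₁`; by (1) it suffices to lift the class `[v] ∈ Hdgᵖ(Gr^W_{2p} H₂)`, which lies in the
image of the morphism of pure Hodge structures `Gr^W_{2p}(f)` from the polarisable
`Gr^W_{2p} H₁` — semisimplicity (Voisin 2025, Cor. 2.12) lifts it to `Hdgᵖ(Gr^W_{2p} H₁) = Hdgᵖ(H₁)`;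
the defect `f u - v` is a Hodge class of `H₂` in `W_{2p-1}`, hence `0`.
[cite: Arapura2022, §1 Lemma 1.1 (2)–(3)] [cite: Voisin2025, Cor. 2.12]
[cite: DeligneHodgeII1971, Thm. 2.3.5 (iii)] -/
theorem Hom.exists_mem_hodgeClasses_apply_eq_of_mem_range [Module.Finite ℚ V]
    {H₁ : MixedHodgeStructure V} {H₂ : MixedHodgeStructure V'} (f : Hom H₁ H₂) {p : ℤ}
    (hW : H₁.W (2 * p - 1) = ⊥) (hpol : (H₁.gr (2 * p)).IsPolarizable) {v : V'}
    (hv : v ∈ H₂.hodgeClasses p) (hrange : v ∈ LinearMap.range f.toLinearMap) :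
    ∃ u ∈ H₁.hodgeClasses p, f.toLinearMap u = v := by
  -- strictness for `W`: a preimage in `W_{2p}`
  obtain ⟨u₀, hu₀W, hu₀v⟩ : ∃ u₀ ∈ H₁.W (2 * p), f.toLinearMap u₀ = v := by
    have h : v ∈ (H₁.W (2 * p)).map f.toLinearMap := by
      rw [f.map_W_eq]
      exact ⟨hv.1, hrange⟩
    exact h
  -- the classes in `Gr^W_{2p}`
  have hy₂ : (Submodule.Quotient.mk ⟨v, hv.1⟩ : grW H₂.W (2 * p)) ∈ (H₂.gr (2 * p)).hodgeClasses p :=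
    mk_mem_hodgeClasses_gr H₂ hv.1 hv.2
  have hgr : (f.gr (2 * p)).toLinearMap (Submodule.Quotient.mk ⟨u₀, hu₀W⟩) =
      Submodule.Quotient.mk ⟨v, hv.1⟩ := by
    rw [gr_toLinearMap, grMap_mk]
    congr 1
    exact Subtype.ext hu₀v
  -- semisimplicity on the pure, polarisable `Gr^W_{2p} H₁`
  obtain ⟨y₁, hy₁, hfy₁⟩ :=
    HodgeStructure.Hom.exists_mem_hodgeClasses_eq_of_mem_range' (f.gr (2 * p)) hpol
      (by ring : p + p = 2 * p) hy₂ ⟨_, hgr⟩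
  -- (1) for `H₁`: the lift is the class of a Hodge class `u₁` of `H₁`
  obtain ⟨⟨u₁, hu₁⟩, rfl⟩ := exists_mem_hodgeClasses_toGr_eq H₁ hW hy₁
  refine ⟨u₁, hu₁, ?_⟩
  -- `f u₁ - v` is a Hodge class of `H₂` lying in `W_{2p-1}`, hence zero by (1) for `H₂`
  have hfu₁ : f.toLinearMap u₁ ∈ H₂.hodgeClasses p := f.apply_mem_hodgeClasses hu₁
  have hdiff : f.toLinearMap u₁ - v ∈ H₂.W (2 * p - 1) := by
    rw [hodgeClassesToGr_apply, gr_toLinearMap, grMap_mk, Submodule.Quotient.eq] at hfy₁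
    exact hfy₁
  exact sub_eq_zero.1
    (eq_zero_of_mem_hodgeClasses_of_mem_W H₂ (Submodule.sub_mem _ hfu₁ hv) hdiff)

/-- **Lemma 1.1 (3), map form**: `f(Hdgᵖ H₁) = Hdgᵖ H₂ ∩ im f` for `f : H₁ → H₂` with `V₁`
finite-dimensional, `W_{2p-1} V₁ = 0` and `Gr^W_{2p} H₁` polarisable.
[cite: Arapura2022, §1 Lemma 1.1 (3)] -/
theorem Hom.map_hodgeClasses_eq_inf_range [Module.Finite ℚ V]
    {H₁ : MixedHodgeStructure V} {H₂ : MixedHodgeStructure V'} (f : Hom H₁ H₂) {p : ℤ}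
    (hW : H₁.W (2 * p - 1) = ⊥) (hpol : (H₁.gr (2 * p)).IsPolarizable) :
    (H₁.hodgeClasses p).map f.toLinearMap = H₂.hodgeClasses p ⊓ LinearMap.range f.toLinearMap := by
  refine le_antisymm (le_inf (f.map_hodgeClasses_le p) ?_) ?_
  · rintro _ ⟨u, -, rfl⟩
    exact LinearMap.mem_range_self _ u
  · rintro v ⟨hv, hrange⟩
    obtain ⟨u, hu, rfl⟩ := f.exists_mem_hodgeClasses_apply_eq_of_mem_range hW hpol hv hrange
    exact ⟨u, hu, rfl⟩

/-- **Lemma 1.1 (3), as printed**: if `H₁ → H₂ → H₃` are morphisms of mixed Hodge structures with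
`ker g ⊆ im f`, and `H₁` is finite-dimensional with `W_{2p-1} V₁ = 0` and `Gr^W_{2p} H₁`
polarisable ("`H₁` polarizable with nonnegative weight"), then
`Hdgᵖ(H₁) → Hdgᵖ(H₂) → Hdgᵖ(H₃)` is exact at `Hdgᵖ(H₂)`: a Hodge class of `H₂` killed by `g` is
the image of a Hodge class of `H₁`. [cite: Arapura2022, §1 Lemma 1.1 (3)] -/
theorem Hom.exists_mem_hodgeClasses_apply_eq_of_exact [Module.Finite ℚ V]
    {H₁ : MixedHodgeStructure V} {H₂ : MixedHodgeStructure V'} {H₃ : MixedHodgeStructure V''}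
    (f : Hom H₁ H₂) (g : Hom H₂ H₃)
    (hfg : LinearMap.ker g.toLinearMap ≤ LinearMap.range f.toLinearMap) {p : ℤ}
    (hW : H₁.W (2 * p - 1) = ⊥) (hpol : (H₁.gr (2 * p)).IsPolarizable) {v : V'}
    (hv : v ∈ H₂.hodgeClasses p) (hgv : g.toLinearMap v = 0) :
    ∃ u ∈ H₁.hodgeClasses p, f.toLinearMap u = v :=
  f.exists_mem_hodgeClasses_apply_eq_of_mem_range hW hpol hv (hfg (LinearMap.mem_ker.2 hgv))

/-- **Lemma 1.1 (2): `Hodge(−)` is exact on polarizable MHS of nonnegative weight** — the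
non-formal half: a morphism `f : H₁ → H₂` which is onto on the underlying spaces, with `V₁`
finite-dimensional, `W_{2p-1} V₁ = 0` and `Gr^W_{2p} H₁` polarisable, is onto on Hodge classes,
`f(Hdgᵖ H₁) = Hdgᵖ H₂` (left exactness of `Hom_MHS(ℚ(-p), −)` being formal).
[cite: Arapura2022, §1 Lemma 1.1 (2)] [cite: Voisin2025, Cor. 2.12] -/
theorem Hom.map_hodgeClasses_eq_of_surjective [Module.Finite ℚ V]
    {H₁ : MixedHodgeStructure V} {H₂ : MixedHodgeStructure V'} (f : Hom H₁ H₂)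
    (hf : Function.Surjective f.toLinearMap) {p : ℤ} (hW : H₁.W (2 * p - 1) = ⊥)
    (hpol : (H₁.gr (2 * p)).IsPolarizable) :
    (H₁.hodgeClasses p).map f.toLinearMap = H₂.hodgeClasses p := by
  rw [f.map_hodgeClasses_eq_inf_range hW hpol, LinearMap.range_eq_top.2 hf, inf_top_eq]

/-- The same statements with the tree's "graded-polarizable" hypothesis (every `Gr^W_k`
polarisable; mixed Hodge structures of geometric origin are graded-polarizable).
[cite: Arapura2022, §1 Lemma 1.1 (2)–(3)] -/
theorem Hom.exists_mem_hodgeClasses_apply_eq_of_isGradedPolarizable [Module.Finite ℚ V]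
    {H₁ : MixedHodgeStructure V} {H₂ : MixedHodgeStructure V'} (f : Hom H₁ H₂)
    (hpol : H₁.IsGradedPolarizable) {p : ℤ} (hW : H₁.W (2 * p - 1) = ⊥) {v : V'}
    (hv : v ∈ H₂.hodgeClasses p) (hrange : v ∈ LinearMap.range f.toLinearMap) :
    ∃ u ∈ H₁.hodgeClasses p, f.toLinearMap u = v :=
  f.exists_mem_hodgeClasses_apply_eq_of_mem_range hW (hpol (2 * p)) hv hrange

/-! ### Sanity checks -/

/-- Non-vacuity: on the Tate structure `ℚ(j)` (pure of weight `-2j`, as an MHS) every rational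
vector is a Hodge class of type `(-j, -j)` … -/
example (j : ℤ) : (HodgeStructure.tate j).toMixedHodgeStructure.hodgeClasses (-j) = ⊤ := by
  rw [HodgeStructure.toMixedHodgeStructure_hodgeClasses _ (by omega), hodgeClasses_tate]

/-- … and there is none of type `(p, p)` for `p < -j` (the weight condition `v ∈ W_{2p} = 0`
fails), so `hodgeClasses` is not trivially everything. -/
example (j p : ℤ) (h : p < -j) :
    (HodgeStructure.tate j).toMixedHodgeStructure.hodgeClasses p = ⊥ := by
  rw [eq_bot_iff]
  rintro v ⟨hv, -⟩
  rwa [HodgeStructure.toMixedHodgeStructure_W,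
    HodgeStructure.trivialWeightFiltration_of_lt (show 2 * p < -2 * j by omega)] at hv

/-- A pure Hodge structure of weight `2p`, as an MHS, has "nonnegative weight after the twist":
`W_{2p-1} = 0`, so Lemma 1.1 (1) applies to it with an equivalence. -/
example {p : ℤ} (G : HodgeStructure V (2 * p)) :
    G.toMixedHodgeStructure.hodgeClasses p ≃ₗ[ℚ] (G.toMixedHodgeStructure.gr (2 * p)).hodgeClasses p :=
  G.toMixedHodgeStructure.hodgeClassesEquivGr p
    (by rw [HodgeStructure.toMixedHodgeStructure_W, HodgeStructure.trivialWeightFiltration_of_lt (by omega)])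

end MixedHodgeStructure

/-! ### Appended (v2): Lemma 1.1 (4) — the `Gr_F`-criterion on pure Hodge structures -/

namespace HodgeStructure

variable {n : ℤ}

/-- **Lemma 1.1 (4), injectivity half**: let `φ : H₁ → H₂` be a morphism of pure Hodge
structures of weight `n = 2p` such that `Grᵖ_F(φ) : Fᵖ H₁ / F^{p+1} H₁ → Fᵖ H₂ / F^{p+1} H₂` is
injective — spelled out: an `x ∈ Fᵖ H₁,ℂ` with `φ_ℂ x ∈ F^{p+1} H₂,ℂ` lies in `F^{p+1} H₁,ℂ`. Then
`φ` is injective on Hodge classes: a Hodge class `h` of `H₁` with `φ h = 0` vanishes (`1 ⊗ h ∈ Fᵖ`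
maps to `0 ∈ F^{p+1}`, so `1 ⊗ h ∈ F^{p+1} ∩ conj Fᵖ = 0`). No polarisation is needed for this
half. [cite: Arapura2022, §1 Lemma 1.1 (4)] -/
theorem Hom.eq_zero_of_mem_hodgeClasses_of_grF_injective {H₁ : HodgeStructure V n}
    {H₂ : HodgeStructure V' n} (φ : Hom H₁ H₂) {p : ℤ} (hp : p + p = n)
    (hGr : ∀ x ∈ H₁.F p, φ.toLinearMap.baseChange ℂ x ∈ H₂.F (p + 1) → x ∈ H₁.F (p + 1))
    {h : V} (hh : h ∈ H₁.hodgeClasses p) (hφh : φ.toLinearMap h = 0) : h = 0 := by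
  rw [mem_hodgeClasses_iff] at hh
  have h0 : φ.toLinearMap.baseChange ℂ (ofRat h) ∈ H₂.F (p + 1) := by
    rw [ofRat_apply, LinearMap.baseChange_tmul, hφh, TensorProduct.tmul_zero]
    exact Submodule.zero_mem _
  have h1 : ofRat h ∈ H₁.F (p + 1) := hGr _ hh h0
  have h2 : ofRat h ∈ complexConj (H₁.F p) := by
    rw [mem_complexConj, conj_ofRat]
    exact hh
  have hbot : ofRat h ∈ H₁.F (p + 1) ⊓ complexConj (H₁.F p) := ⟨h1, h2⟩
  rw [(H₁.isCompl_F_complexConj (p + 1) p (by omega)).inf_eq_bot, Submodule.mem_bot] at hbot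
  exact ofRat_injective (by rw [hbot, map_zero])

/-- **Lemma 1.1 (4), injectivity half, subspace form**: `ker φ ∩ Hdgᵖ(H₁) = 0`.
[cite: Arapura2022, §1 Lemma 1.1 (4)] -/
theorem Hom.ker_inf_hodgeClasses_eq_bot_of_grF_injective {H₁ : HodgeStructure V n}
    {H₂ : HodgeStructure V' n} (φ : Hom H₁ H₂) {p : ℤ} (hp : p + p = n)
    (hGr : ∀ x ∈ H₁.F p, φ.toLinearMap.baseChange ℂ x ∈ H₂.F (p + 1) → x ∈ H₁.F (p + 1)) :
    LinearMap.ker φ.toLinearMap ⊓ H₁.hodgeClasses p = ⊥ := by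
  rw [eq_bot_iff]
  rintro h ⟨hker, hh⟩
  rw [Submodule.mem_bot]
  exact φ.eq_zero_of_mem_hodgeClasses_of_grF_injective hp hGr hh (LinearMap.mem_ker.1 hker)

/-- **Lemma 1.1 (4), surjectivity half**: let `φ : H₁ → H₂` be a morphism of pure Hodge
structures of weight `n = 2p` with `H₁` finite-dimensional and polarisable, such that
`Grᵖ_F(φ) : Fᵖ H₁ / F^{p+1} H₁ → Fᵖ H₂ / F^{p+1} H₂` is surjective — spelled out:
`Fᵖ H₂,ℂ ⊆ φ_ℂ(Fᵖ H₁,ℂ) + F^{p+1} H₂,ℂ`. Then `φ` is surjective on Hodge classes: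
`Hdgᵖ(H₂) ⊆ φ(Hdgᵖ(H₁))`. Printed proof: `coker(Hodge(H₁) → Hodge(H₂)) = Hodge(coker φ) ⊆
Gr_F(coker φ) = 0`; here the same weight argument is run inside `H₂`: for a Hodge class `h`,
`1 ⊗ h = φ_ℂ x + y` with `x ∈ Fᵖ`, `y ∈ F^{p+1}`; split `x = x' + b` along
`V₁,ℂ = F^{p+1} ⊕ conj Fᵖ` (`b ∈ Fᵖ ∩ conj Fᵖ = V₁^{p,p}`); then `1 ⊗ h - φ_ℂ b ∈ F^{p+1} ∩ conj Fᵖ = 0`,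
so `1 ⊗ h ∈ im φ_ℂ = (im φ)_ℂ`, `h ∈ im φ`, and a Hodge class in the image of a morphism from a
polarisable Hodge structure lifts to a Hodge class (Voisin 2025, Cor. 2.12,
`Hom.exists_mem_hodgeClasses_eq_of_mem_range'`). [cite: Arapura2022, §1 Lemma 1.1 (4)]
[cite: Voisin2025, Cor. 2.12] -/
theorem Hom.hodgeClasses_le_map_of_grF_surjective [Module.Finite ℚ V] {H₁ : HodgeStructure V n}
    {H₂ : HodgeStructure V' n} (φ : Hom H₁ H₂) (hH₁ : H₁.IsPolarizable) {p : ℤ} (hp : p + p = n)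
    (hGr : H₂.F p ≤ (H₁.F p).map (φ.toLinearMap.baseChange ℂ) ⊔ H₂.F (p + 1)) :
    H₂.hodgeClasses p ≤ (H₁.hodgeClasses p).map φ.toLinearMap := by
  intro h hh
  have hhF : ofRat h ∈ H₂.F p := hh
  -- surjectivity on `Grᵖ_F`: `1 ⊗ h = φ_ℂ x + y`, `x ∈ Fᵖ H₁`, `y ∈ F^{p+1} H₂`
  obtain ⟨a, ha, y, hy, hay⟩ := Submodule.mem_sup.1 (hGr hhF)
  obtain ⟨x, hx, rfl⟩ := ha
  -- split `x = x' + b` along `V₁,ℂ = F^{p+1} ⊕ conj Fᵖ`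
  have htop := (H₁.isCompl_F_complexConj (p + 1) p (by omega)).sup_eq_top
  obtain ⟨x', hx', b, hb, rfl⟩ := Submodule.mem_sup.1
    (show x ∈ H₁.F (p + 1) ⊔ complexConj (H₁.F p) by rw [htop]; exact Submodule.mem_top)
  rw [mem_complexConj] at hb
  set φc := φ.toLinearMap.baseChange ℂ with hφc
  -- the defect `1 ⊗ h - φ_ℂ b` lies in `F^{p+1} ∩ conj Fᵖ = 0`
  have hd1 : ofRat h - φc b ∈ H₂.F (p + 1) := by
    have heq : ofRat h - φc b = φc x' + y := by
      rw [← hay, map_add]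
      abel
    rw [heq]
    exact Submodule.add_mem _ (φ.map_F_le (p + 1) ⟨x', hx', rfl⟩) hy
  have hd2 : ofRat h - φc b ∈ complexConj (H₂.F p) := by
    refine Submodule.sub_mem _ ?_ ?_
    · rw [mem_complexConj, conj_ofRat]
      exact hhF
    · rw [mem_complexConj, hφc, conj_baseChange]
      exact φ.map_F_le p ⟨_, hb, rfl⟩
  have hd : ofRat h - φc b = 0 := by
    have hmem : ofRat h - φc b ∈ H₂.F (p + 1) ⊓ complexConj (H₂.F p) := ⟨hd1, hd2⟩
    rwa [(H₂.isCompl_F_complexConj (p + 1) p (by omega)).inf_eq_bot, Submodule.mem_bot] at hmem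
  -- hence `1 ⊗ h ∈ im φ_ℂ = (im φ)_ℂ`, `h ∈ im φ`, and the Hodge class `h` lifts (Cor. 2.12)
  have hrange : h ∈ LinearMap.range φ.toLinearMap := by
    apply mem_of_ofRat_mem_baseChange
    rw [← range_baseChange]
    exact ⟨b, (sub_eq_zero.1 hd).symm⟩
  obtain ⟨h', hh', rfl⟩ := φ.exists_mem_hodgeClasses_eq_of_mem_range' hH₁ hp hh hrange
  exact ⟨h', hh', rfl⟩

/-- **Lemma 1.1 (4), surjectivity half, subspace form**: `φ(Hdgᵖ(H₁)) = Hdgᵖ(H₂)`.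
[cite: Arapura2022, §1 Lemma 1.1 (4)] -/
theorem Hom.map_hodgeClasses_eq_of_grF_surjective [Module.Finite ℚ V] {H₁ : HodgeStructure V n}
    {H₂ : HodgeStructure V' n} (φ : Hom H₁ H₂) (hH₁ : H₁.IsPolarizable) {p : ℤ} (hp : p + p = n)
    (hGr : H₂.F p ≤ (H₁.F p).map (φ.toLinearMap.baseChange ℂ) ⊔ H₂.F (p + 1)) :
    (H₁.hodgeClasses p).map φ.toLinearMap = H₂.hodgeClasses p := by
  refine le_antisymm ?_ (φ.hodgeClasses_le_map_of_grF_surjective hH₁ hp hGr)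
  rintro _ ⟨h', hh', rfl⟩
  have hh'F : ofRat h' ∈ H₁.F p := hh'
  rw [mem_hodgeClasses_iff]
  have heq : φ.toLinearMap.baseChange ℂ (ofRat h') = ofRat (φ.toLinearMap h') := by
    rw [ofRat_apply, ofRat_apply, LinearMap.baseChange_tmul]
  rw [← heq]
  exact φ.map_F_le p ⟨_, hh'F, rfl⟩

end HodgeStructure

end Literature.AlgebraicGeometry.Motives

end
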